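import Literature.NumberTheory.NumberFields.RelativeDifferentExponents
import HarnessLib

/-!
# Exponents of the different in a THREE-field tower `F₀ ⊆ F ⊆ K` of number fields, prime by prime

Topic `NumberTheory/NumberFields`; theorems only (no definition, no named fact). Sequel of
`RelativeDifferentExponents.lean` (two fields). For number fields `F₀ ⊆ F ⊆ K`, a maximal ideal `P` of
`𝓞 K`, `Q = P ∩ 𝓞 F`, relative ramification indices `e' = e(P | Q)` (`P.ramificationIdx (𝓞 F)`),
`e'' = e(Q | Q ∩ 𝓞 F₀)` (`Q.ramificationIdx (𝓞 F₀)`), absolute index `e_P = e(P | p)` (`P.ramificationIdx ℤ`)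
and residue characteristic `p`:

* `multiplicity_differentIdeal_tower` — **transitivity, exponent form:
  `ord_P 𝔇_{K/F₀} = ord_P 𝔇_{K/F} + e'·ord_Q 𝔇_{F/F₀}`** (Mathlib's
  `differentIdeal_eq_differentIdeal_mul_differentIdeal` — `𝔇_{K/F₀} = 𝔇_{K/F}·𝔇_{F/F₀}𝓞_K`, Neukirch III
  (2.2) (c) — and `emultiplicity_map_eq_ramificationIdx'_mul`, `ord_P(𝔞𝓞_K) = e'·ord_Q(𝔞)`);
* `ramificationIdx_tower_rel`, `ramificationIdx_rel_eq_one_of_eq_one_of_eq_one`,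
  `not_dvd_ramificationIdx_rel_of_not_dvd_of_not_dvd` — `e(P | Q ∩ 𝓞 F₀) = e''·e'`; unramified over
  unramified is unramified; tame over tame is tame (Neukirch II (7.8)/(7.9) for the local statements; here
  only the multiplicativity of `e` is used);
* `multiplicity_differentIdeal_tower_succ_le_of_not_dvd_top` — **`K/F` TAME at `P`, `F/F₀` GALOIS with
  `[F:F₀] ∣ M`: `ord_P 𝔇_{K/F₀} + 1 ≤ e_P·(v_p(M) + 1)`** (`(e' - 1) + e'·ord_Q 𝔇_{F/F₀}` with
  Dedekind–Hensel `ord_Q 𝔇_{F/F₀} + 1 ≤ e_Q·(v_p(M) + 1)` for the Galois layer);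
* `multiplicity_differentIdeal_tower_succ_le_of_not_dvd_bot` — **`K/F` GALOIS with `[K:F] ∣ N`, `F/F₀`
  TAME at `Q`: `ord_P 𝔇_{K/F₀} + 1 ≤ e_P·(v_p(N) + 1)`** (`ord_P 𝔇_{K/F} ≤ e' - 1 + ord_P(e')`,
  Bombieri–Gubler B.2.11, plus `e'·(e'' - 1)`, and `e'·e'' ≤ e_P`, `ord_P(e') ≤ ord_P(N) = e_P·v_p(N)`).

These are the per-prime inputs of [IUTchIV] Thm. 1.10 Step (ii) for the tower `F_tpd ⊆ F ⊆ K` read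
DIRECTLY from `F_tpd` to `K` (the printed `log(2^11·3^3·5^2)` over `2·3·5` — `F/F_tpd` Galois, `K/F` tame
there — and `2·log(l)` over `l` — `K/F` Galois, `F/F_tpd` tame there), which is the form in which the
printed constants survive when `E_F` has bad reduction at places dividing `2l` (cell abc-iut, finding
F-Sd1g3-1 / L5-t15 01:41Z: the intermediate `F`-level display does not). The global bookkeeping is
`Literature/IUT/LogVolume/DifferentConductorTowerThreeField.lean`. Classical algebraic number theory;
nothing here belongs to the disputed corpus.

## References

* J. Neukirch, *Algebraic Number Theory*, Springer (1999), Ch. III (2.2) (c) (`𝔇_{M|K} = 𝔇_{M|L}𝔇_{L|K}`),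
  (2.6); Ch. II (7.8), (7.9); Ch. I (8.2), (9.3). [NeukirchANT1999]
* E. Bombieri, W. Gubler, *Heights in Diophantine Geometry*, CUP (2006), App. B, Thm. B.2.11.
  [BombieriGubler2006]
-/

noncomputable section

open NumberField IsDedekindDomain Ideal UniqueFactorizationMonoid

namespace Literature.NumberTheory.NumberFields

variable (F₀ F K : Type*) [Field F₀] [NumberField F₀] [Field F] [NumberField F] [Field K] [NumberField K]
  [Algebra F₀ F] [Algebra F K] [Algebra F₀ K] [IsScalarTower F₀ F K]

/-! ### Ramification indices in the tower -/

omit [NumberField F₀] [NumberField K] in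
/-- **`e(P | P ∩ 𝓞 F₀) = e(Q | Q ∩ 𝓞 F₀) · e(P | Q)`** for `Q = P ∩ 𝓞 F` (multiplicativity of ramification
indices, Mathlib `Ideal.ramificationIdx_tower`). [cite: NeukirchANT1999, Ch. II (7.8)] -/
theorem ramificationIdx_tower_rel (P : Ideal (𝓞 K)) :
    P.ramificationIdx (𝓞 F₀) = (P.under (𝓞 F)).ramificationIdx (𝓞 F₀) * P.ramificationIdx (𝓞 F) :=
  Ideal.ramificationIdx_tower (R := 𝓞 F₀) (P.under (𝓞 F)) P

omit [NumberField F₀] [NumberField K] in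
/-- Unramified over unramified is unramified: `e(P|Q) = 1`, `e(Q|Q ∩ 𝓞 F₀) = 1 ⇒ e(P|P ∩ 𝓞 F₀) = 1`.
[cite: NeukirchANT1999, Ch. II (7.8)] -/
theorem ramificationIdx_rel_eq_one_of_eq_one_of_eq_one (P : Ideal (𝓞 K))
    (htop : P.ramificationIdx (𝓞 F) = 1) (hbot : (P.under (𝓞 F)).ramificationIdx (𝓞 F₀) = 1) :
    P.ramificationIdx (𝓞 F₀) = 1 := by
  rw [ramificationIdx_tower_rel F₀ F K P, htop, hbot]

omit [NumberField F₀] [NumberField K] in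
/-- Tame over tame is tame: `p ∤ e(P|Q)`, `p ∤ e(Q|Q ∩ 𝓞 F₀) ⇒ p ∤ e(P|P ∩ 𝓞 F₀)` for a prime `p`.
[cite: NeukirchANT1999, Ch. II (7.9)] -/
theorem not_dvd_ramificationIdx_rel_of_not_dvd_of_not_dvd (P : Ideal (𝓞 K)) {p : ℕ} (hp : p.Prime)
    (htop : ¬ p ∣ P.ramificationIdx (𝓞 F)) (hbot : ¬ p ∣ (P.under (𝓞 F)).ramificationIdx (𝓞 F₀)) :
    ¬ p ∣ P.ramificationIdx (𝓞 F₀) := by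
  rw [ramificationIdx_tower_rel F₀ F K P]
  exact fun h => (hp.dvd_mul.mp h).elim hbot htop

omit [NumberField F₀] [NumberField K] [Algebra F₀ F] [Algebra F₀ K] [IsScalarTower F₀ F K] in
/-- **`e(P | p) = e(Q | p) · e(P | Q)`** along `ℤ ⊆ 𝓞 F ⊆ 𝓞 K` (`Q = P ∩ 𝓞 F`).
[cite: NeukirchANT1999, Ch. II (7.8)] -/
theorem ramificationIdx_int_eq_mul (P : Ideal (𝓞 K)) :
    P.ramificationIdx ℤ = (P.under (𝓞 F)).ramificationIdx ℤ * P.ramificationIdx (𝓞 F) :=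
  Ideal.ramificationIdx_tower (R := ℤ) (P.under (𝓞 F)) P

omit [NumberField K] [Algebra F K] [Algebra F₀ K] [IsScalarTower F₀ F K] in
/-- `e(Q | Q ∩ 𝓞 F₀) ≤ e(Q | p)` (the absolute index is a multiple of every relative one).
[cite: NeukirchANT1999, Ch. II (7.8)] -/
theorem ramificationIdx_rel_le_int (Q : Ideal (𝓞 F)) [Q.IsMaximal] :
    Q.ramificationIdx (𝓞 F₀) ≤ Q.ramificationIdx ℤ :=
  Nat.le_of_dvd (Ideal.ramificationIdx_pos Q ℤ) (ramificationIdx_rel_dvd_ramificationIdx_int F₀ F Q)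

/-! ### Transitivity of the different, exponent by exponent -/

/-- **Transitivity of the different in the tower `F₀ ⊆ F ⊆ K`, exponent form**: for a maximal ideal `P`
of `𝓞 K` and `Q = P ∩ 𝓞 F`, `ord_P 𝔇_{K/F₀} = ord_P 𝔇_{K/F} + e(P|Q) · ord_Q 𝔇_{F/F₀}` — from
`𝔇_{K/F₀} = 𝔇_{K/F} · 𝔇_{F/F₀}𝓞_K` (Mathlib `differentIdeal_eq_differentIdeal_mul_differentIdeal`) and
`ord_P(𝔞 𝓞_K) = e(P|Q) · ord_Q(𝔞)` (Mathlib `emultiplicity_map_eq_ramificationIdx'_mul`).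
[cite: NeukirchANT1999, Ch. III (2.2)] -/
theorem multiplicity_differentIdeal_tower (P : Ideal (𝓞 K)) [P.IsMaximal] :
    multiplicity P (differentIdeal (𝓞 F₀) (𝓞 K)) =
      multiplicity P (differentIdeal (𝓞 F) (𝓞 K)) +
        P.ramificationIdx (𝓞 F) * multiplicity (P.under (𝓞 F)) (differentIdeal (𝓞 F₀) (𝓞 F)) := by
  classical
  have hP : P ≠ ⊥ := Ideal.IsMaximal.ne_bot_of_isIntegral_int P
  have hPp : Prime P := prime_of_isPrime hP inferInstance
  haveI : (P.under (𝓞 F)).IsMaximal := IsMaximal.under (𝓞 F) P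
  have hQ : P.under (𝓞 F) ≠ ⊥ := Ideal.IsMaximal.ne_bot_of_isIntegral_int _
  have hQp : Prime (P.under (𝓞 F)) := prime_of_isPrime hQ inferInstance
  -- transitivity of the different (Mathlib), over the fraction rings of the rings of integers
  letI := FractionRing.liftAlgebra (𝓞 F₀) (FractionRing (𝓞 K))
  haveI := isSeparable_fractionRing_ringOfIntegers F₀ K
  have htrans : differentIdeal (𝓞 F₀) (𝓞 K) =
      differentIdeal (𝓞 F) (𝓞 K) * (differentIdeal (𝓞 F₀) (𝓞 F)).map (algebraMap (𝓞 F) (𝓞 K)) :=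
    differentIdeal_eq_differentIdeal_mul_differentIdeal (𝓞 F₀) (𝓞 F) (𝓞 K)
  have hD0 : differentIdeal (𝓞 F₀) (𝓞 K) ≠ ⊥ := differentIdeal_ne_bot
  have hDF : differentIdeal (𝓞 F₀) (𝓞 F) ≠ ⊥ := differentIdeal_ne_bot
  have hfin : FiniteMultiplicity P (differentIdeal (𝓞 F) (𝓞 K) *
      (differentIdeal (𝓞 F₀) (𝓞 F)).map (algebraMap (𝓞 F) (𝓞 K))) := by
    rw [← htrans]; exact FiniteMultiplicity.of_prime_left hPp hD0
  rw [htrans, multiplicity_mul hPp hfin]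
  congr 1
  -- `ord_P(𝔞 𝓞_K) = e(P|Q)·ord_Q(𝔞)`
  have hmap : (differentIdeal (𝓞 F₀) (𝓞 F)).map (algebraMap (𝓞 F) (𝓞 K)) ≠ ⊥ := map_ne_bot_of_ne_bot hDF
  have hfinmap := FiniteMultiplicity.of_prime_left hPp hmap
  have hfinQ := FiniteMultiplicity.of_prime_left hQp hDF
  have key := Ideal.IsDedekindDomain.emultiplicity_map_eq_ramificationIdx'_mul (S := 𝓞 K)
    (v := P.under (𝓞 F)) (w := P) hDF hQp.irreducible hPp.irreducible hP
  rw [hfinmap.emultiplicity_eq_multiplicity, hfinQ.emultiplicity_eq_multiplicity,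
    ramificationIdx'_eq_ramificationIdx (P.under (𝓞 F)) P hQ] at key
  exact_mod_cast key

/-! ### The two per-prime bounds for the direct passage `F₀ → K` -/

/-- **`K/F` tame at `P`, `F/F₀` Galois with `[F:F₀] ∣ M` (`M ≠ 0`): `ord_P 𝔇_{K/F₀} + 1 ≤ e(P|p)·(v_p(M) + 1)`**,
`p` the residue characteristic of `P` — transitivity, the tame equality `ord_P 𝔇_{K/F} = e(P|Q) - 1`
(Neukirch III (2.6)) and Dedekind–Hensel for the Galois layer (`ord_Q 𝔇_{F/F₀} + 1 ≤ e(Q|p)·(v_p(M) + 1)`):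
`(e' - 1) + e'·ord_Q 𝔇_{F/F₀} + 1 = e'·(ord_Q 𝔇_{F/F₀} + 1) ≤ e'·e(Q|p)·(v_p M + 1) = e(P|p)·(v_p M + 1)`.
This is [IUTchIV] Thm. 1.10 Step (ii) at the primes over `2·3·5` read from `F_tpd` straight to `K`
(`F/F_tpd` Galois inside `GL₂(𝔽₃) × GL₂(𝔽₅) × ℤ/2ℤ`, `K/F` tame there since `l ∤ 2·3·5`).
[cite: NeukirchANT1999, Ch. III (2.6)] -/
theorem multiplicity_differentIdeal_tower_succ_le_of_not_dvd_top [IsGalois F₀ F] (P : Ideal (𝓞 K))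
    [P.IsMaximal] {M : ℕ} (hM : M ≠ 0) (hdvd : Module.finrank F₀ F ∣ M)
    (htame : ¬ Ideal.absNorm (P.under ℤ) ∣ P.ramificationIdx (𝓞 F)) :
    multiplicity P (differentIdeal (𝓞 F₀) (𝓞 K)) + 1 ≤
      P.ramificationIdx ℤ * (M.factorization (Ideal.absNorm (P.under ℤ)) + 1) := by
  haveI : (P.under (𝓞 F)).IsMaximal := IsMaximal.under (𝓞 F) P
  rw [multiplicity_differentIdeal_tower F₀ F K P, multiplicity_differentIdeal_eq_of_not_dvd F K P htame,
    ramificationIdx_int_eq_mul F K P]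
  have hpQ : Ideal.absNorm ((P.under (𝓞 F)).under ℤ) = Ideal.absNorm (P.under ℤ) := by
    rw [Ideal.under_under]
  have h1 := multiplicity_differentIdeal_lt_of_isGalois F₀ F (P.under (𝓞 F)) hM hdvd
  rw [hpQ] at h1
  have he : 1 ≤ P.ramificationIdx (𝓞 F) := Ideal.ramificationIdx_pos P (𝓞 F)
  set e' := P.ramificationIdx (𝓞 F)
  set a := multiplicity (P.under (𝓞 F)) (differentIdeal (𝓞 F₀) (𝓞 F))
  set eQ := (P.under (𝓞 F)).ramificationIdx ℤ
  set m := M.factorization (Ideal.absNorm (P.under ℤ))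
  have h2 : e' * (a + 1) ≤ e' * (eQ * (m + 1)) := Nat.mul_le_mul_left e' h1
  have h3 : e' - 1 + e' * a + 1 = e' * (a + 1) := by
    obtain ⟨k, hk⟩ := Nat.exists_eq_add_of_le he
    rw [hk]; ring_nf; omega
  calc e' - 1 + e' * a + 1 = e' * (a + 1) := h3
    _ ≤ e' * (eQ * (m + 1)) := h2
    _ = eQ * e' * (m + 1) := by ring

/-- **`K/F` Galois with `[K:F] ∣ N` (`N ≠ 0`), `F/F₀` tame at `Q = P ∩ 𝓞 F`:
`ord_P 𝔇_{K/F₀} + 1 ≤ e(P|p)·(v_p(N) + 1)`** — transitivity, the tame equality `ord_Q 𝔇_{F/F₀} = e(Q|q) - 1`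
for the bottom layer, and for the Galois layer the SHARP Dedekind bound `ord_P 𝔇_{K/F} ≤ e' - 1 + ord_P(e')`
(Bombieri–Gubler B.2.11) with `ord_P(e') ≤ ord_P(N) = e(P|p)·v_p(N)` (`e' ∣ [K:F] ∣ N`):
`ord_P 𝔇_{K/F₀} + 1 ≤ e'·e'' + e(P|p)·v_p(N) ≤ e(P|p)·(v_p(N) + 1)` since `e'·e'' ∣ e(P|p)`. This is
[IUTchIV] Thm. 1.10 Step (ii) at the primes over `l` read from `F_tpd` straight to `K` (`K/F` Galois inside
`GL₂(𝔽_l)`, `v_l(|GL₂(𝔽_l)|) = 1`, `F/F_tpd` tame at `l ∤ 2^{10}·3^2·5`): the composite costs `2·log(l)`, NOT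
`3·log(l)` as the coarse `ord_P 𝔇_{K/F} + 1 ≤ 2·e(P|l)` composed with the tame layer would give.
[cite: BombieriGubler2006, Thm. B.2.11] -/
theorem multiplicity_differentIdeal_tower_succ_le_of_not_dvd_bot [IsGalois F K] (P : Ideal (𝓞 K))
    [P.IsMaximal] {N : ℕ} (hN : N ≠ 0) (hdvd : Module.finrank F K ∣ N)
    (htame : ¬ Ideal.absNorm (P.under ℤ) ∣ (P.under (𝓞 F)).ramificationIdx (𝓞 F₀)) :
    multiplicity P (differentIdeal (𝓞 F₀) (𝓞 K)) + 1 ≤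
      P.ramificationIdx ℤ * (N.factorization (Ideal.absNorm (P.under ℤ)) + 1) := by
  haveI : (P.under (𝓞 F)).IsMaximal := IsMaximal.under (𝓞 F) P
  have hpQ : Ideal.absNorm ((P.under (𝓞 F)).under ℤ) = Ideal.absNorm (P.under ℤ) := by
    rw [Ideal.under_under]
  have htame' : ¬ Ideal.absNorm ((P.under (𝓞 F)).under ℤ) ∣ (P.under (𝓞 F)).ramificationIdx (𝓞 F₀) := by
    rwa [hpQ]
  rw [multiplicity_differentIdeal_tower F₀ F K P,
    multiplicity_differentIdeal_eq_of_not_dvd F₀ F (P.under (𝓞 F)) htame']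
  -- the Galois layer `K/F`: `ord_P 𝔇_{K/F} + 1 ≤ e' + ord_P(e')`, `ord_P(e') ≤ ord_P(N) = e(P|p)·v_p(N)`
  have h1 := multiplicity_differentIdeal_succ_le_of_isGalois F K P
  have h2 := multiplicity_span_natCast_mono K P hN
    ((ramificationIdx_dvd_finrank_of_isGalois (P.under (𝓞 F)) P).trans hdvd)
  rw [multiplicity_span_natCast K P hN] at h2
  -- `e'·e'' ≤ e(P|p)`
  have h3 : P.ramificationIdx (𝓞 F) * (P.under (𝓞 F)).ramificationIdx (𝓞 F₀) ≤ P.ramificationIdx ℤ := by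
    rw [ramificationIdx_int_eq_mul F K P, mul_comm]
    exact Nat.mul_le_mul_right _ (ramificationIdx_rel_le_int F₀ F (P.under (𝓞 F)))
  have he'' : 1 ≤ (P.under (𝓞 F)).ramificationIdx (𝓞 F₀) := Ideal.ramificationIdx_pos _ (𝓞 F₀)
  obtain ⟨k, hk⟩ := Nat.exists_eq_add_of_le he''
  rw [hk] at h3 ⊢
  have hk1 : 1 + k - 1 = k := by omega
  rw [hk1]
  nlinarith [h1, h2, h3]

end Literature.NumberTheory.NumberFields

end
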